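/-
Copyright (c) 2026 the pub-hodgecm-mathlib formalisation cell (harness21).  Prover seat hodgecm-mathlib-K2E3-p05 (g2), Track B «K2-LIT», engine E3, unit U4 «Keys»,
2026-09-04.  KERNEL module: THEOREMS ONLY (no definition, no named fact, no `sorry`, no instance, no notation).
-/
import Summits.HodgeConjecture.HodgeConjecture.Theorems.K2E3IwahoriCodetection      -- ★-filed p856454 (this seat): `not_fixedPoints_I_le`; brings ★ II-3 `exists_ne_zero_mem_inf_fixedPoints_I`, ★ II-1
import HarnessLib

/-!
# K2 ∕ E3 «EllipticInputs», unit U4 «Keys» — Road II of MEMO `hK-KeysThmTwo`, stub II-3″ «THE IWAHORI LINE»: for a regular unramified principal series `i_G(χ)` of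
# `U(Φ₃)(L⁺_v)` (`v` inert) and a `G`-stable `⊥ ≠ N ≠ ⊤`, `N ∩ (ℂ f₁ ⊕ ℂ f_w)` is a LINE — the hypothesis `hline` (with its vector `u`) of ★ p855172 `criterion_of_iwahoriLine`
# [Borel1976 §4; Casselman1980 §3; Casselman1995 Thm. 3.3.3]

Cell hodgecm-mathlib (D-0151), FLOOR 0, Track B «K2-LIT», engine E3, crux item H413 = stmt-HodgeConjecture-24833 (route `HCCMUnconditional`, no route verbs); target BY NAME
`…K2E3EllipticInputs.U4Keys.sig_K2E3KeysThmTwoContracting` (U4-f), unramified first rung (Road II).  Author K2E3-p05 (g2).  `--supports stmt-HodgeConjecture-24833 --as helper`.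
GLUE ONLY: ★ II-3 (`0 ≠ u ∈ N ∩ V^I`), ★-filed II-3′ (`V^I ⊄ N`), ★ II-1 (`V^I = ℂ f₁ ⊕ ℂ f_w`: every `I`-fixed `f` is `f(1) f₁ + f(w̃) f_w`, and `f₁, f_w` are independent by their values at `1, w̃`),
and two-dimensional linear algebra: a non-zero proper subspace of a plane is a line.  Output `exists_iwahoriLine`: the binders `u hu0 huN huI hline` of ★ p855172 VERBATIM (with
`Submodule.span ℂ {f₁, f_w}`), so the assembly II-4 is `criterion_of_iwahoriLine … (★ II-2a) (★ II-2b) u hu0 huN huI hline` followed by arithmetic.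
HONEST LABEL: HC_CM is proved only modulo the 7 printed citations (2 remaining named inputs: hLiu418 = stmt-HodgeConjecture-24832, h413 = stmt-HodgeConjecture-24833)
until rung 0 closes; count-neutral.

## References
* [Borel1976] A. Borel, Invent. Math. 35 (1976), §4.  * [Casselman1980] W. Casselman, Compositio Math. 40 (1980), §3.  * [Casselman1995] notes (1995), Thm. 3.3.3.
-/

set_option autoImplicit false
-- the mandated namespace has the single-problem summit's repeated segment (`HodgeConjecture.HodgeConjecture`)
set_option linter.dupNamespace false

noncomputable section

open NumberField IsDedekindDomain MeasureTheory
open scoped Matrix MatrixGroups NNReal WithZero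
open Literature.NumberTheory Literature.NumberTheory.Automorphic Literature.NumberTheory.Automorphic.UnitaryGroup
open Literature.NumberTheory.Rogawski1990 Literature.NumberTheory.GaloisRepresentations

namespace Summit.HodgeConjecture.HodgeConjecture.Cruxes.H413.K2E3IwahoriLine

open Summit.HodgeConjecture.HodgeConjecture.Cruxes.H413
open Summit.HodgeConjecture.HodgeConjecture.Cruxes.H413.K2E3PSIwahoriBasis
open Summit.HodgeConjecture.HodgeConjecture.Cruxes.H413.K2E3IwahoriDetection
open Summit.HodgeConjecture.HodgeConjecture.Cruxes.H413.K2E3IwahoriCodetection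

/-! ## §1 Linear algebra: a non-zero proper subspace of a plane is a line -/

/-- In the plane `P = ℂ f₁ ⊕ ℂ f_w` (`f₁, f_w` independent): if `u ≠ 0`, `u, u' ∈ P ∩ S` for a subspace `S` NOT containing `P`, then `u' ∈ ℂ u`. [folklore] -/
theorem exists_eq_smul_of_not_le {V : Type*} [AddCommGroup V] [Module ℂ V] {f₁ f_w : V} (hlin : LinearIndependent ℂ ![f₁, f_w])
    (S : Submodule ℂ V) (hS : ¬ Submodule.span ℂ ({f₁, f_w} : Set V) ≤ S)
    {u : V} (hu0 : u ≠ 0) (huS : u ∈ S) (huP : u ∈ Submodule.span ℂ ({f₁, f_w} : Set V))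
    {u' : V} (hu'S : u' ∈ S) (hu'P : u' ∈ Submodule.span ℂ ({f₁, f_w} : Set V)) : ∃ t : ℂ, u' = t • u := by
  by_contra hnot
  push Not at hnot
  -- `u, u'` are independent, hence span the plane
  have hpair : LinearIndependent ℂ ![u, u'] := by
    refine LinearIndependent.pair_iff.2 fun s t hst => ?_
    by_cases ht : t = 0
    · subst ht
      rw [zero_smul, add_zero] at hst
      exact ⟨(smul_eq_zero.1 hst).resolve_right hu0, rfl⟩
    · exfalso
      apply hnot (-(t⁻¹ * s))
      have : t • u' = -(s • u) := eq_neg_of_add_eq_zero_right hst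
      calc u' = t⁻¹ • (t • u') := by rw [smul_smul, inv_mul_cancel₀ ht, one_smul]
        _ = -(t⁻¹ * s) • u := by rw [this, smul_neg, smul_smul, neg_smul]
  have hrange : ∀ a b : V, ({a, b} : Set V) = Set.range ![a, b] := fun a b => by
    ext x
    simp only [Set.mem_insert_iff, Set.mem_singleton_iff, Set.mem_range]
    constructor
    · rintro (rfl | rfl)
      exacts [⟨0, rfl⟩, ⟨1, rfl⟩]
    · rintro ⟨i, rfl⟩
      fin_cases i
      · exact Or.inl rfl
      · exact Or.inr rfl
  have h2P : Module.finrank ℂ ↥(Submodule.span ℂ ({f₁, f_w} : Set V)) = 2 := by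
    rw [hrange, finrank_span_eq_card hlin]; simp
  have h2Q : Module.finrank ℂ ↥(Submodule.span ℂ ({u, u'} : Set V)) = 2 := by
    rw [hrange, finrank_span_eq_card hpair]; simp
  have hle : Submodule.span ℂ ({u, u'} : Set V) ≤ Submodule.span ℂ ({f₁, f_w} : Set V) :=
    Submodule.span_le.2 (Set.insert_subset_iff.2 ⟨huP, Set.singleton_subset_iff.2 hu'P⟩)
  haveI : FiniteDimensional ℂ ↥(Submodule.span ℂ ({f₁, f_w} : Set V)) := FiniteDimensional.span_of_finite ℂ (Set.toFinite _)
  have heq : Submodule.span ℂ ({u, u'} : Set V) = Submodule.span ℂ ({f₁, f_w} : Set V) :=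
    Submodule.eq_of_le_of_finrank_eq hle (by rw [h2Q, h2P])
  apply hS
  rw [← heq]
  exact Submodule.span_le.2 (Set.insert_subset_iff.2 ⟨huS, Set.singleton_subset_iff.2 hu'S⟩)

/-! ## §2 The Iwahori line -/

variable (L : Type) [Field L] [NumberField L] [IsCMField L] (v : HeightOneSpectrum (𝓞 ↥(maximalRealSubfield L)))
  (w : PlacesOver L v) (hw : IsCMField.complexConj L • w.1 = w.1)
  (eA : Gqs L v ≃ₜ* ↥(unitaryGroupOfForm (galAdicCompletionMap (L := L) (IsCMField.complexConj L) hw) ((StdForm.antidiagonal 3).over (w.1.adicCompletion L))))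
  (heA : ∀ g : Gqs L v,
    ((eA g : ↥(unitaryGroupOfForm (galAdicCompletionMap (L := L) (IsCMField.complexConj L) hw) ((StdForm.antidiagonal 3).over (w.1.adicCompletion L)))) : GL (Fin 3) (w.1.adicCompletion L)) =
      ((localNonsplitEquiv (IsCMField.complexConj L) (qsForm L) (IsCMField.complexConj_ne_one L) w hw g :
        ↥(unitaryGroupOfForm (galAdicCompletionMap (L := L) (IsCMField.complexConj L) hw) (placeForm (qsForm L) w.1))) : GL (Fin 3) (w.1.adicCompletion L)))

include heA in
set_option maxHeartbeats 12000000 in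
set_option synthInstance.maxHeartbeats 400000 in
-- statement∕proof-heavy: the `SmoothInd` carrier of `cmPrincipalSeries` (class of ★ II-1 §3 ∕ ★ II-2a §3)
/-- **THE IWAHORI LINE.**  `v` inert ((G3)-EXPLICIT letters), `χ = (χ₁, χ₂)` continuous, REGULAR, `χ` and `wχ` trivial on `T ∩ K_v`, `(f₁, f_w)` the Iwahori pair of ★ II-1, `⊥ ≠ N ≠ ⊤` a `G`-stable subspace
of `i_G(χ)`: there is `u ≠ 0` in `N ∩ (ℂ f₁ ⊕ ℂ f_w)` such that every vector of `N ∩ (ℂ f₁ ⊕ ℂ f_w)` is a multiple of `u` — ★ II-3 + ★-filed II-3′ + ★ II-1 + §1.  The binders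
`u hu0 huN huI hline` of ★ p855172 `criterion_of_iwahoriLine`. [cite: Borel1976, §4] [cite: Casselman1980, §3] -/
theorem exists_iwahoriLine (hns : ∀ w' : PlacesOver L v, IsCMField.complexConj L • w'.1 = w'.1) {ϖ : w.1.adicCompletion L}
    (hd : HermitianLattice.UnramifiedLocalConjDatum (galAdicCompletionMap (L := L) (IsCMField.complexConj L) hw) ϖ)
    (g₁ : GL (Fin 3) (w.1.adicCompletion L)) (hg₁ : (g₁ : Matrix (Fin 3) (Fin 3) (w.1.adicCompletion L)) = Matrix.diagonal ![(1 : w.1.adicCompletion L), 1, ϖ])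
    (K0 K1 I : Subgroup (Gqs L v))
    (hK0 : K0 = ((glInt 3 (w.1.adicCompletion L)).subgroupOf
      (unitaryGroupOfForm (galAdicCompletionMap (L := L) (IsCMField.complexConj L) hw) ((StdForm.antidiagonal 3).over (w.1.adicCompletion L)))).comap
        eA.toMulEquiv.toMonoidHom)
    (hK1 : K1 = (((glInt 3 (w.1.adicCompletion L)).map (MulAut.conj g₁).toMonoidHom).subgroupOf
      (unitaryGroupOfForm (galAdicCompletionMap (L := L) (IsCMField.complexConj L) hw) ((StdForm.antidiagonal 3).over (w.1.adicCompletion L)))).comap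
        eA.toMulEquiv.toMonoidHom)
    (hI : I = K0 ⊓ K1)
    (χ₁ : (LocalRing L v)ˣ →* ℂˣ) (χ₂ : ↥(normOneUnits (conjLocal L (IsCMField.complexConj L) v)) →* ℂˣ)
    (h₁ : Continuous fun x => ((χ₁ x : ℂˣ) : ℂ)) (h₂ : Continuous fun x => ((χ₂ x : ℂˣ) : ℂ))
    (hreg : cmTorusCharPair L v χ₁ χ₂ ≠ cmTorusCharPair L v (conjInvChar (conjLocal L (IsCMField.complexConj L) v) χ₁) χ₂)
    (hU : ∀ t : ↥(torusU (conjLocal L (IsCMField.complexConj L) v) (cmLocalForm L 3 v)),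
      (t : ↥(unitaryGroupOfForm (conjLocal L (IsCMField.complexConj L) v) (cmLocalForm L 3 v))) ∈ cmLocalIntegralLevel L 3 (qsForm L) v → cmTorusCharPair L v χ₁ χ₂ t = 1)
    (hUw : ∀ t : ↥(torusU (conjLocal L (IsCMField.complexConj L) v) (cmLocalForm L 3 v)),
      (t : ↥(unitaryGroupOfForm (conjLocal L (IsCMField.complexConj L) v) (cmLocalForm L 3 v))) ∈ cmLocalIntegralLevel L 3 (qsForm L) v →
        cmTorusCharPair L v (conjInvChar (conjLocal L (IsCMField.complexConj L) v) χ₁) χ₂ t = 1)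
    (N : Subrepresentation (cmPrincipalSeries L 3 v (cmTorusCharPair L v χ₁ χ₂))) (hbot : N ≠ ⊥) (htop : N ≠ ⊤) :
    haveI := locallyCompactSpace_cmBorelU L 3 v
    ∀ (f₁ f_w : Representation.SmoothInd (cmBorelTriple L 3 v).P
        (Representation.twist (((Representation.trivial ℂ ↥(torusU (conjLocal L (IsCMField.complexConj L) v) (cmLocalForm L 3 v)) ℂ).twist (cmTorusCharPair L v χ₁ χ₂)).comp
          (cmBorelTriple L 3 v).proj) (rootDeltaChar (cmBorelTriple L 3 v).P))),
      f₁ ∈ (cmPrincipalSeries L 3 v (cmTorusCharPair L v χ₁ χ₂)).fixedPoints I → f_w ∈ (cmPrincipalSeries L 3 v (cmTorusCharPair L v χ₁ χ₂)).fixedPoints I →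
      f₁.toFun 1 = 1 →
      f₁.toFun (eA.symm (weylLongU (galAdicCompletionMap (L := L) (IsCMField.complexConj L) hw) (rfl : (StdForm.antidiagonal 3).over (w.1.adicCompletion L) = _))) = 0 →
      f_w.toFun 1 = 0 →
      f_w.toFun (eA.symm (weylLongU (galAdicCompletionMap (L := L) (IsCMField.complexConj L) hw) (rfl : (StdForm.antidiagonal 3).over (w.1.adicCompletion L) = _))) = 1 →
      ∃ u : Representation.SmoothInd (cmBorelTriple L 3 v).P
          (Representation.twist (((Representation.trivial ℂ ↥(torusU (conjLocal L (IsCMField.complexConj L) v) (cmLocalForm L 3 v)) ℂ).twist (cmTorusCharPair L v χ₁ χ₂)).comp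
            (cmBorelTriple L 3 v).proj) (rootDeltaChar (cmBorelTriple L 3 v).P)),
        u ≠ 0 ∧ u ∈ N.toSubmodule ∧ u ∈ Submodule.span ℂ ({f₁, f_w} : Set _) ∧
        ∀ u' ∈ N.toSubmodule, u' ∈ Submodule.span ℂ ({f₁, f_w} : Set _) → ∃ t : ℂ, u' = t • u := by
  haveI := locallyCompactSpace_cmBorelU L 3 v
  intro f₁ f_w hf₁ hf_w h11 h1w hw1 hww
  -- ★ II-3: a non-zero `I`-fixed vector of `N`
  obtain ⟨u, huN, huI, hu0⟩ := exists_ne_zero_mem_inf_fixedPoints_I L v w hw eA heA hns hd g₁ hg₁ K0 K1 I hK0 hK1 hI χ₁ χ₂ h₁ h₂ hU N hbot htop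
  -- ★ II-1: `V^I ⊆ ℂ f₁ ⊕ ℂ f_w`
  have hVI : ∀ f, f ∈ (cmPrincipalSeries L 3 v (cmTorusCharPair L v χ₁ χ₂)).fixedPoints I → f ∈ Submodule.span ℂ ({f₁, f_w} : Set _) := by
    intro f hf
    rw [eq_of_mem_fixedPoints_I L v w hw eA heA hd g₁ hg₁ K0 K1 I hK0 hK1 hI (cmTorusCharPair L v χ₁ χ₂) f₁ f_w f hf₁ hf_w hf h11 h1w hw1 hww,
      Submodule.mem_span_pair]
    exact ⟨_, _, rfl⟩
  -- `f₁, f_w` independent (values at `1`, `w̃`)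
  have hlin : LinearIndependent ℂ ![f₁, f_w] := by
    refine LinearIndependent.pair_iff.2 fun s t hst => ?_
    have h0 : (0 : Representation.SmoothInd (cmBorelTriple L 3 v).P
        (Representation.twist (((Representation.trivial ℂ ↥(torusU (conjLocal L (IsCMField.complexConj L) v) (cmLocalForm L 3 v)) ℂ).twist (cmTorusCharPair L v χ₁ χ₂)).comp
          (cmBorelTriple L 3 v).proj) (rootDeltaChar (cmBorelTriple L 3 v).P))).toFun = 0 := by
      have h := Representation.SmoothInd.toFun_smul (0 : ℂ) f₁
      rw [zero_smul] at h
      rw [h, zero_smul]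
    have h0' : ∀ g, (0 : Representation.SmoothInd (cmBorelTriple L 3 v).P
        (Representation.twist (((Representation.trivial ℂ ↥(torusU (conjLocal L (IsCMField.complexConj L) v) (cmLocalForm L 3 v)) ℂ).twist (cmTorusCharPair L v χ₁ χ₂)).comp
          (cmBorelTriple L 3 v).proj) (rootDeltaChar (cmBorelTriple L 3 v).P))).toFun g = 0 := fun g => by rw [h0]; rfl
    have e1 : (s • f₁ + t • f_w).toFun 1 = (0 : Representation.SmoothInd (cmBorelTriple L 3 v).P
        (Representation.twist (((Representation.trivial ℂ ↥(torusU (conjLocal L (IsCMField.complexConj L) v) (cmLocalForm L 3 v)) ℂ).twist (cmTorusCharPair L v χ₁ χ₂)).comp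
          (cmBorelTriple L 3 v).proj) (rootDeltaChar (cmBorelTriple L 3 v).P))).toFun 1 := by rw [hst]
    have ew : (s • f₁ + t • f_w).toFun (eA.symm (weylLongU (galAdicCompletionMap (L := L) (IsCMField.complexConj L) hw) (rfl : (StdForm.antidiagonal 3).over (w.1.adicCompletion L) = _))) =
        (0 : Representation.SmoothInd (cmBorelTriple L 3 v).P
        (Representation.twist (((Representation.trivial ℂ ↥(torusU (conjLocal L (IsCMField.complexConj L) v) (cmLocalForm L 3 v)) ℂ).twist (cmTorusCharPair L v χ₁ χ₂)).comp
          (cmBorelTriple L 3 v).proj) (rootDeltaChar (cmBorelTriple L 3 v).P))).toFun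
          (eA.symm (weylLongU (galAdicCompletionMap (L := L) (IsCMField.complexConj L) hw) (rfl : (StdForm.antidiagonal 3).over (w.1.adicCompletion L) = _))) := by rw [hst]
    rw [h0', Representation.SmoothInd.toFun_add, Representation.SmoothInd.toFun_smul, Representation.SmoothInd.toFun_smul,
      Pi.add_apply, Pi.smul_apply, Pi.smul_apply] at e1 ew
    rw [h11, hw1, smul_eq_mul, smul_eq_mul, mul_one, mul_zero, add_zero] at e1
    rw [h1w, hww, smul_eq_mul, smul_eq_mul, mul_zero, mul_one, zero_add] at ew
    exact ⟨e1, ew⟩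
  -- ★-filed II-3′: the plane is not inside `N`
  have hS : ¬ Submodule.span ℂ ({f₁, f_w} : Set _) ≤ N.toSubmodule := by
    intro hle
    refine not_fixedPoints_I_le L v w hw eA heA hns hd g₁ hg₁ K0 K1 I hK0 hK1 hI χ₁ χ₂ h₁ h₂ hreg hU hUw N htop fun f hf => hle (hVI f hf)
  refine ⟨u, hu0, huN, hVI u huI, fun u' hu'N hu'P => exists_eq_smul_of_not_le hlin N.toSubmodule hS hu0 huN (hVI u huI) hu'N hu'P⟩

end Summit.HodgeConjecture.HodgeConjecture.Cruxes.H413.K2E3IwahoriLine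

end
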